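import Summits.QuantumFields.YangMills.Theorems.FiniteSusceptibilityWeakCoupling.Negative.SimpleLoadBearing

/-!
# `DecorrelationForcesSummability` (rate half of `FiniteSusceptibilityWeakCoupling`) — simplicity is load-bearing

Negative-side support for the RATE child **stmt-QuantumFields-18061 `DecorrelationForcesSummability`** of crux
`stmt-QuantumFields-9442` (`FradkinShenkerFlow.FiniteSusceptibilityWeakCoupling`; cut `crux ⟺ NoEvenLongRangeOrder ∧
DecorrelationForcesSummability`, `…SpeciesParity.finiteSusceptibilityWeakCoupling_iff_even_subs`). The child says: for compact
SIMPLE `G`, at every large `β`, uniform time-axis decorrelation of all pairs of species forces the crux's susceptibility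
clause. The crux-strategist (STRATEGY-CENSUS gen 2 §1, §N10, §Outcome) records that this is the half which carries the
hypothesis `IsCompactSimpleLieGroup`: in the `U(1)₄` Coulomb phase all pairs decorrelate (power-law clustering) while the
`C`-odd field strength `sin θ_p` has the free-photon `|x|⁻⁴` two-point function, not summable in `d = 4`. This file types
that record, MODULO the two `U(1)₄` torus/Wilson-action inputs (both believed, neither in print in this form — Guth 1980 /
Fröhlich–Spencer 1982 work with the Villain action and free or infinite-volume states; cf.
`Literature.Barriers.QuantumFields.AbelianMasslessPhaseD4`):

* `rateHalf_false_without_simple_of_u1` — if at arbitrarily large `β` the `U(1)₄` torus states decorrelate (the child's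
  hypothesis at `G = U(1)`, `r = u1Rep`) AND some pair of `U(1)` species has unbounded torus susceptibility at that `β`, then
  the child with `IsCompactSimpleLieGroup G →` deleted is false;
* `rateHalf_false_without_simple_of_u1Sine` — the same with the pair specialised to the sine plaquette
  (`Negative.exists_u1SinePlaquetteSpecies`).

No named `Prop` and no `def` is introduced (statements inline, as in `Negative/SimpleLoadBearing.lean`). [folklore]
-/

noncomputable section

open MeasureTheory ProbabilityTheory Finset
open Literature.MathematicalPhysics.QuantumFieldTheory hiding ZdEdge
open Literature.MathematicalPhysics.QuantumLattice
open Literature.Probability.LatticeModels hiding configShift configShift_apply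

namespace Summit.QuantumFields.YangMills.Theorems.FiniteSusceptibilityWeakCoupling.Negative

/-- **The rate half needs simplicity (modulo the `U(1)₄` Coulomb-phase inputs).** HYPOTHESIS `h`: at arbitrarily large
`β`, (i) every pair of bounded gauge-invariant local observables of Wilson-action `U(1)₄` decorrelates along the time axis
uniformly in the odd tori (`latticeConnectedCorr` vocabulary — the child's own hypothesis at `G = U(1)`), and (ii) some
pair `A, B : YMSpecies Circle` has unbounded torus susceptibility at that `β`. CONCLUSION: item stmt-QuantumFields-18061
`DecorrelationForcesSummability` with `IsCompactSimpleLieGroup G →` deleted is false — instantiate at `G = U(1) = Circle`,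
`r = u1Rep`: the weakened statement turns (i) into the susceptibility clause at `β`, contradicting (ii). [folklore] -/
theorem rateHalf_false_without_simple_of_u1
    (h : ∀ β₁ : ℝ, ∃ β : ℝ, β₁ ≤ β ∧
      (∀ A B : YMSpecies Circle, ∀ ε : ℝ, 0 < ε → ∃ n₀ : ℕ, ∀ S n : ℕ, n₀ ≤ n → n ≤ S →
        |latticeConnectedCorr u1Rep β (2 * S + 1) A.F B.F n| ≤ ε) ∧
      (∃ A B : YMSpecies Circle, ∀ χ : ℝ, ∃ S : ℕ,
        χ < ∑ x ∈ box 4 S, |cov[fun U => A.F (torusLift (2 * S + 1) U),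
          fun U => B.F (configShift (-x) (torusLift (2 * S + 1) U));
          wilsonMeasure (d := 4) (L := 2 * S + 1) u1Rep β]|)) :
    ¬ ∀ (G : Type) [Group G] [TopologicalSpace G] [IsTopologicalGroup G] [CompactSpace G]
        [MeasurableSpace G] [BorelSpace G],
        ∀ r : LatticeRep G, ∃ β₀ : ℝ, ∀ β : ℝ, β₀ ≤ β →
          (∀ A B : YMSpecies G, ∀ ε : ℝ, 0 < ε → ∃ n₀ : ℕ, ∀ S n : ℕ, n₀ ≤ n → n ≤ S →
            |latticeConnectedCorr r.ρ β (2 * S + 1) A.F B.F n| ≤ ε) →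
          ∀ A B : YMSpecies G, ∃ χ : ℝ, ∀ S : ℕ,
            ∑ x ∈ box 4 S, |cov[fun U => A.F (torusLift (2 * S + 1) U),
              fun U => B.F (configShift (-x) (torusLift (2 * S + 1) U));
              wilsonMeasure (d := 4) (L := 2 * S + 1) r.ρ β]| ≤ χ := by
  intro hW
  obtain ⟨β₀, hβ₀⟩ := hW Circle ⟨1, u1Rep, continuous_u1Rep, u1Rep_injective, u1Rep_mem_unitaryGroup⟩
  obtain ⟨β, hβ, hdec, A, B, hAB⟩ := h β₀
  obtain ⟨χ, hχ⟩ := hβ₀ β hβ hdec A B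
  obtain ⟨S, hS⟩ := hAB χ
  exact (lt_irrefl χ) (lt_of_lt_of_le hS (hχ S))

/-- **The rate half needs simplicity — sine-plaquette form.** As `rateHalf_false_without_simple_of_u1`, with the
non-summable pair specialised to the `C`-odd field-strength observable `Im U_p = sin θ_p` of the `(0,1)` plaquette at the
origin (a `YMSpecies Circle` by `Negative.exists_u1SinePlaquetteSpecies`): HYPOTHESIS = at arbitrarily large `β`, `U(1)₄`
torus decorrelation of all pairs AND unbounded torus susceptibility `∑_{x ∈ box 4 S} |Cov_{β,2S+1}(sin θ_p, sin θ_{p+x})|`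
(free photon, Fröhlich–Spencer CMP 83 (1982) §2.11 for the Villain action; open for the Wilson action in this form).
CONCLUSION: the rate child without `IsCompactSimpleLieGroup` is false. [folklore] -/
theorem rateHalf_false_without_simple_of_u1Sine
    (h : ∀ β₁ : ℝ, ∃ β : ℝ, β₁ ≤ β ∧
      (∀ A B : YMSpecies Circle, ∀ ε : ℝ, 0 < ε → ∃ n₀ : ℕ, ∀ S n : ℕ, n₀ ≤ n → n ≤ S →
        |latticeConnectedCorr u1Rep β (2 * S + 1) A.F B.F n| ≤ ε) ∧
      (∀ χ : ℝ, ∃ S : ℕ,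
        χ < ∑ x ∈ box 4 S,
          |cov[fun U => ((plaquetteHolonomyZd (torusLift (2 * S + 1) U) 0 0 1 : Circle) : ℂ).im,
            fun U => ((plaquetteHolonomyZd (configShift (-x) (torusLift (2 * S + 1) U)) 0 0 1 : Circle) : ℂ).im;
            wilsonMeasure (d := 4) (L := 2 * S + 1) u1Rep β]|)) :
    ¬ ∀ (G : Type) [Group G] [TopologicalSpace G] [IsTopologicalGroup G] [CompactSpace G]
        [MeasurableSpace G] [BorelSpace G],
        ∀ r : LatticeRep G, ∃ β₀ : ℝ, ∀ β : ℝ, β₀ ≤ β →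
          (∀ A B : YMSpecies G, ∀ ε : ℝ, 0 < ε → ∃ n₀ : ℕ, ∀ S n : ℕ, n₀ ≤ n → n ≤ S →
            |latticeConnectedCorr r.ρ β (2 * S + 1) A.F B.F n| ≤ ε) →
          ∀ A B : YMSpecies G, ∃ χ : ℝ, ∀ S : ℕ,
            ∑ x ∈ box 4 S, |cov[fun U => A.F (torusLift (2 * S + 1) U),
              fun U => B.F (configShift (-x) (torusLift (2 * S + 1) U));
              wilsonMeasure (d := 4) (L := 2 * S + 1) r.ρ β]| ≤ χ := by
  obtain ⟨P, hP⟩ := exists_u1SinePlaquetteSpecies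
  refine rateHalf_false_without_simple_of_u1 fun β₁ => ?_
  obtain ⟨β, hβ, hdec, hsin⟩ := h β₁
  refine ⟨β, hβ, hdec, P, P, ?_⟩
  simpa only [hP] using hsin

/-- Conversely, the rate child restricted to simple groups is implied by the crux (a clause that holds outright
holds under any hypothesis) — so the weakening differs from the child exactly by the non-simple groups it lets in,
of which `U(1)` (`Negative.circle_not_isCompactSimpleLieGroup`) is the one with a mechanism. [folklore] -/
theorem rateHalf_on_simple_of_crux
    (h : Summit.QuantumFields.YangMills.Theses.FradkinShenkerFlow.FiniteSusceptibilityWeakCoupling)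
    (G : Type) [Group G] [TopologicalSpace G] [IsTopologicalGroup G] [CompactSpace G]
    [MeasurableSpace G] [BorelSpace G] (hG : IsCompactSimpleLieGroup G) (r : LatticeRep G) :
    ∃ β₀ : ℝ, ∀ β : ℝ, β₀ ≤ β →
      (∀ A B : YMSpecies G, ∀ ε : ℝ, 0 < ε → ∃ n₀ : ℕ, ∀ S n : ℕ, n₀ ≤ n → n ≤ S →
        |latticeConnectedCorr r.ρ β (2 * S + 1) A.F B.F n| ≤ ε) →
      ∀ A B : YMSpecies G, ∃ χ : ℝ, ∀ S : ℕ,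
        ∑ x ∈ box 4 S, |cov[fun U => A.F (torusLift (2 * S + 1) U),
          fun U => B.F (configShift (-x) (torusLift (2 * S + 1) U));
          wilsonMeasure (d := 4) (L := 2 * S + 1) r.ρ β]| ≤ χ := by
  obtain ⟨β₀, hβ₀⟩ := h G hG r
  exact ⟨β₀, fun β hβ _ => hβ₀ β hβ⟩

end Summit.QuantumFields.YangMills.Theorems.FiniteSusceptibilityWeakCoupling.Negative

end
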